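import Summits.BirchSwinnertonDyer.BirchSwinnertonDyer.Theorems.KatoDescentPotSupersingularWildUpperHeegnerSharpRoad
import Summits.BirchSwinnertonDyer.BirchSwinnertonDyer.Theorems.KatoDescentPotSupersingularWildFineSelmerCongruenceFact
import HarnessLib

/-!
# Route `KatoDescentPotSupersingular` (rung K9, cell `bsd-potss`, B5 O6 wild `3`): the BODY of the U₀-ns node
# `WildUpperNonsurjTower` (item 19189) with the ♯ / Manin-dirty rows dischargeable PER ROW by ANY of the cell's three
# currencies — (i) the Kolyvagin–Jetchev sharp index bound (p473967), (ii) Coates–Sujatha's (A) at the row (crux 19386),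
# (iii) ONE congruent anchor carrying (A) or finite `Sel_{3^∞}[3]` (k9-c4 / conjA-anchor; Lim–Sujatha) — route-free
# `--supports` file (seat `bsd-potss-k8t-c4` g6, courtesy K9 twin of `…TameUpperNonsurjCurrencies`); nothing booked, no
# item closed, BSD not proved by any of this

The K9 twin of `TameUpperHeegnerSharpRoad.upperNonsurjTower_of_lower_of_rankOne_of_sharpCurrencies`: ONE term for the
planner's re-cut of crux 19386 in which each ♯ (`3 ∣ ∏c_ℓ`) or Manin-dirty (no datum of level `N_E` with `3 ∤ c`)
non-CM row carries the DISJUNCTION of the three currencies. Rows: CM → Burungale–Flach; Manin-clean ♭ → k9-c4's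
Heegner road over Matar–Nekovář's printed bound (no currency needed); otherwise (i) ⇒ the sharp Heegner road
(`WildUpperHeegnerSharpRoad.missingUpperBoundAt_wildIrr_rankZero_of_lower_of_rankOne_of_sharpIndexBound`), (ii) ⇒ the
fine-Selmer port of Kato 14.5 (3), (iii) ⇒ (ii) by Lim–Sujatha 2018 Prop. 3.2 (`WildFineSelmerCongruenceFact.conjA_of_modPCongruent`,
`WildFineSelmerOrdinaryAnchor.conjA_rat_of_finite_selmerInfty_pTorsion`); Greenberg-unit ordinary anchors (k9-c4 g4's
third sub-currency) convert to (iii)'s finite-`Sel[3]` form by `WildFineSelmerOrdinaryUnitAnchor.finite_selmerInfty_pTorsion_of_unitData`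
at the caller. HONEST STATUS: (i) = Jetchev 2008 Thm. 1.4 / Cor. 1.5 in the irreducible reading (Rem. 6.2 + MN19 §0.11;
at the wild `3` the rows whose Tamagawa-3 prime is `3` itself — 77 / 159 census ♯ rows, kit j262010 — also need the
unprinted `v ∣ p` step of `AdditiveThree.JetchevBoundAtP`); (ii) = Conj. A (open); (iii) = per-row certificate.
Conditional throughout; nothing asserted; NO item is closed.

References: [Jetchev2008] Thm. 1.4, Cor. 1.5, Rem. 6.2; [MatarNekovar2019] Thm. 0.3, §0.11; [LimSujatha2018] Prop. 3.2;
[Kato2004Asterisque] Thm. 14.5 (3), Prop. 14.16 (2); [CoatesSujatha2005] Conj. A; [BurungaleFlach2024] Cor. 2;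
[BumpFriedbergHoffstein1990]; [GrossZagier1986] I.6.3; [Miller2011LMS] Def. 1.1.
-/

set_option autoImplicit false
-- the Theorems directory repeats the summit name (sibling precedent `KatoDescentPotSupersingularAssembly.lean`)
set_option linter.dupNamespace false

noncomputable section

open scoped Classical NumberField

namespace Summit.BirchSwinnertonDyer.BirchSwinnertonDyer.Theorems.WildUpperHeegnerSharpRoad

open WeierstrassCurve NumberField
  Literature.NumberTheory.EllipticCurves
  Literature.NumberTheory.EllipticCurves.ModularForms
  Literature.NumberTheory.EllipticCurves.Rank1Residual
  Literature.NumberTheory.EllipticCurves.Rank1Residual.Typed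
  Summit.BirchSwinnertonDyer.Rank1Residual
  Summit.BirchSwinnertonDyer.Rank1Residual.Additive
  Summit.BirchSwinnertonDyer.Rank1Residual.O6
  Summit.BirchSwinnertonDyer.BirchSwinnertonDyer.Theorems

/-! ### §1 Private re-homing: the fine-Selmer port on an irreducible O6 row -/

/-- **The upper half on an irreducible rank-`0` O6 row from the finite generation of `Y(E/ℚ^cyc)` over `ℤ₃`**
(private; Kato 14.5 (3) in the fine-Selmer reading bounds `ord₃ #Ш + v₃(∏c_ℓ)` by `ord₃(L/Ω)`, `#Ш_an =
(L/Ω)·#tors²/∏c_ℓ`, torsion term killed by irreducibility — the row version of k9-c4/g3's private lemmas).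
[cite: Kato2004Asterisque, Thm. 14.5 (3) (p. 236), Thm. 12.5 (3) (p. 222), 14.14 (p. 243), Prop. 14.16 (2) (p. 244)]
[cite: Lim2017FineSelmer, §3] [cite: Miller2011LMS, Def. 1.1] -/
private theorem missingUpperBoundAt_wild_of_irreducible_of_fineSelmerDual_fg
    (hKatoA :
      Kato2004.rankZero_padicValNat_sha_add_padicValNat_tamagawa_le_of_additive_potGood_of_irreducible_of_fineSelmerDual_fg)
    (hGZK : rank_eq_analyticRank_of_analyticRank_le_one) (hmod : hasEntireLFunction_rat)
    (W : WeierstrassCurve ℚ) [W.IsElliptic] [W.IsGloballyMinimal] [Fact (3 : ℕ).Prime]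
    (hr : W.analyticRank = 0) (hO : ClassO6 W 3) (hirr : W.HasIrreducibleModPGaloisRep 3)
    (hA : ∀ (κ : ZpExtension ℚ 3), κ.IsCyclotomic →
      ∃ (γ : Field.absoluteGaloisGroup ℚ) (D : W.FineSelmerDualData κ γ),
        Module.Finite ℤ_[3] (RestrictScalars ℤ_[3] (IwasawaAlgebra 3) D.X)) :
    MissingUpperBoundAt W 3 := by
  have hL : W.entireLFunction 1 ≠ 0 := (W.analyticRank_eq_zero_iff_holds (hmod W)).mp hr
  obtain ⟨hmw, hfin⟩ := hGZK W (by rw [hr]; exact zero_le_one)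
  haveI : Finite W.sha := hfin
  have hmw0 : W.mordellWeilRank = 0 := by rw [hmw, hr]
  obtain ⟨q₀, hq₀, hle⟩ := hKatoA W 3 hO.1 hO.2.1.1 hO.2.1.2 hO.padicValRat_j_nonneg hirr hA hL hfin
  have hΩ : (W.realPeriodRat : ℂ) ≠ 0 := by exact_mod_cast W.realPeriodRat_pos_holds.ne'
  have hc0 : 0 < W.tamagawaProduct := W.tamagawaProduct_pos_holds
  have ht0 : 0 < W.torsionOrder := W.torsionOrder_pos_holds
  have hq₀0 : q₀ ≠ 0 := by
    rintro rfl
    rw [Rat.cast_zero, div_eq_zero_iff] at hq₀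
    exact hq₀.elim hL hΩ
  refine ⟨q₀ * (W.torsionOrder : ℚ) ^ 2 / (W.tamagawaProduct : ℚ), ?_, ?_⟩
  · have hLq : W.entireLFunction 1 = (q₀ : ℂ) * (W.realPeriodRat : ℂ) := by
      rw [← hq₀, div_mul_cancel₀ _ hΩ]
    rw [shaAn_def, W.leadingLCoeff_eq_of_analyticRank_eq_zero hr,
      W.regulator_eq_one_of_rank_zero hmw0, hLq]
    push_cast
    field_simp
  · have ht : (W.torsionOrder : ℚ) ≠ 0 := by exact_mod_cast ht0.ne'
    have hcq : (W.tamagawaProduct : ℚ) ≠ 0 := by exact_mod_cast hc0.ne'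
    have hsha : padicValNat 3 (Nat.card (AddCommGroup.primaryComponent W.sha 3)) =
        padicValNat 3 W.shaOrder := by
      unfold WeierstrassCurve.shaOrder
      exact padicValNat_card_addPrimaryComponent 3
    have htors : padicValNat 3 W.torsionOrder = 0 := padicValNat_torsionOrder_eq_zero_of_irreducible W 3 hirr
    have hv : padicValRat 3 (q₀ * (W.torsionOrder : ℚ) ^ 2 / (W.tamagawaProduct : ℚ)) =
        padicValRat 3 q₀ + 2 * (padicValNat 3 W.torsionOrder : ℤ) -
          (padicValNat 3 W.tamagawaProduct : ℤ) := by
      rw [padicValRat.div (mul_ne_zero hq₀0 (pow_ne_zero 2 ht)) hcq,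
        padicValRat.mul hq₀0 (pow_ne_zero 2 ht), pow_two, padicValRat.mul ht ht,
        padicValRat.of_nat, padicValRat.of_nat]
      ring
    rw [hv, ← hsha, htors, Nat.cast_zero, mul_zero, add_zero]
    linarith

/-! ### §2 The U₀-ns BODY (19189) with the per-row currency disjunction -/

/-- **The BODY of the U₀-ns node `WildUpperNonsurjTower` (item 19189) with ONE PER-ROW CURRENCY DISJUNCTION on the
non-CM rows that are ♯ (`3 ∣ ∏c_ℓ`) or Manin-dirty (no datum of level `N_E` with `3 ∤ c`).** Inputs: the `∀ N W K`
schemata of Gross–Zagier (`hGZ`), Kolyvagin (`hKo`), Matar–Nekovář's irreducible Ш-index bound (`hMN`); newforms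
(`hnf`); Bump–Friedberg–Hoffstein (`hBFH`); the bodies of the K9 cite items (`hK`: A161″ ∧ GZK ∧ modularity; `hF`:
Kato 14.5 (3) in the fine-Selmer reading ∧ the CM triple), of L₀ `WildLowerHalfRankZero` (19195, `h₂`) and of the
residual `WildRankOne` (19200, `hR`); Lim–Sujatha 2018 Prop. 3.2 (`hLS`); and `hrow`: on each such row EITHER (i) a
datum `D` of level `N_E` with `3 ∤ c(D)` together with the Kolyvagin–Jetchev sharp index bound at the Heegner fields of
`E` (`ord₃ #Ш(E/K) + 2·ord₃ ∏c_ℓ(E) ≤ 2·ord₃ [E(K):ℤy_K]`, `y_K` the Heegner point of `D`, non-torsion, `d_K < −4`), OR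
(ii) (A) at `(E,3)`, OR (iii) a curve `W′/ℚ` with `W′[3] ≃ W[3]` carrying (A) at `(W′,3)` or finite
`Sel_{3^∞}(W′/ℚ^cyc)[3]`. Proof, row by row: CM → Burungale–Flach; Manin-clean ♭ → k9-c4's road; otherwise the
supplied currency: (i) → the sharp Heegner road; (ii) → the fine-Selmer port; (iii) → (ii) by Lim–Sujatha → the port.
Conditional; nothing asserted; NO item is closed.
[cite: Jetchev2008, Thm. 1.4, Cor. 1.5, Rem. 6.2 (pp. 3, 15)] [cite: LimSujatha2018, §3 Prop. 3.2]
[cite: MatarNekovar2019, Thm. 0.3 (p. 456), §0.11 (p. 457)] [cite: CoatesSujatha2005, Conjecture A]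
[cite: Kato2004Asterisque, Thm. 14.5 (3) (p. 236), Prop. 14.16 (2) (p. 244)] [cite: BurungaleFlach2024, Thm. 1.1 and Cor. 2 (p. 4)] -/
theorem wildUpperNonsurjTower_of_lower_of_rankOne_of_sharpCurrencies
    (hGZ : ∀ (N : ℕ) [NeZero N] (W : WeierstrassCurve ℚ) (K : Type) [Field K] [NumberField K],
      gross_zagier N W K)
    (hKo : ∀ (N : ℕ) [NeZero N] (W : WeierstrassCurve ℚ) (K : Type) [Field K] [NumberField K],
      kolyvagin N W K)
    (hMN : ∀ (N : ℕ) [NeZero N] (W : WeierstrassCurve ℚ) (K : Type) [Field K] [NumberField K],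
      MatarNekovar2019.thm03_padicValNat_card_sha_le_of_irreducible N W K)
    (hnf : exists_isNewformOf) (hBFH : bumpFriedbergHoffstein_exists_heegnerField_split_twist_simpleZero)
    (hK : Kato2004.rankZero_padicValNat_sha_add_padicValNat_tamagawa_le_of_additive_potGood_of_imageContainsSL2 ∧
      rank_eq_analyticRank_of_analyticRank_le_one ∧ WeierstrassCurve.hasEntireLFunction_rat)
    (hF : Kato2004.rankZero_padicValNat_sha_add_padicValNat_tamagawa_le_of_additive_potGood_of_irreducible_of_fineSelmerDual_fg ∧
      bsdTriple_of_hasCM_of_L_one_ne_zero)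
    (h₂ : ∀ (W : WeierstrassCurve ℚ) [W.IsElliptic] [W.IsGloballyMinimal] [Fact (3 : ℕ).Prime],
      W.analyticRank = 0 → ClassO6 W 3 → MissingLowerBoundAt W 3)
    (hR : ∀ (W : WeierstrassCurve ℚ) [W.IsElliptic] [W.IsGloballyMinimal] [Fact (3 : ℕ).Prime],
      W.analyticRank = 1 → ClassO6 W 3 → MissingPPartAt W 3)
    (hLS : LimSujatha2018.prop32_fineSelmerDual_moduleFinite_iff_of_torsionIso)
    (hrow : ∀ (W : WeierstrassCurve ℚ) [W.IsElliptic] [W.IsGloballyMinimal] [Fact (3 : ℕ).Prime],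
      W.analyticRank = 0 → ClassO6 W 3 → W.HasIrreducibleModPGaloisRep 3 →
      ¬ (∀ n : ℕ, W.HasSurjectiveModNGaloisRep (3 ^ n : ℕ)) →
      (3 ∣ W.tamagawaProduct ∨ ∀ [NeZero (W.conductorNorm ℤ)]
        (D : ModularParametrizationData W (W.conductorNorm ℤ)), (3 : ℤ) ∣ D.maninConstant) →
      ¬ W.HasCM →
      (∀ [NeZero (W.conductorNorm ℤ)], ∃ D : ModularParametrizationData W (W.conductorNorm ℤ),
          ¬ (3 : ℤ) ∣ D.maninConstant ∧
          ∀ (K : Type) [Field K] [NumberField K], IsImaginaryQuadratic K →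
            SatisfiesHeegnerHypothesis (W.conductorNorm ℤ) K → NumberField.discr K < -4 →
            ∀ (H : HeegnerDatum (W.conductorNorm ℤ) (NumberField.discr K)) (ι : K →+* ℂ)
              (P : (W.baseChange K).toAffine.Point),
              WeierstrassCurve.Affine.Point.map ι.toRatAlgHom P = heegnerPointComplex D H →
              ¬ IsOfFinAddOrder P →
              padicValNat 3 (Nat.card (W.baseChange K).sha) + 2 * padicValNat 3 W.tamagawaProduct ≤
                2 * padicValNat 3 (AddSubgroup.zmultiples P).index) ∨
      (∀ (κ : ZpExtension ℚ 3), κ.IsCyclotomic →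
          ∃ (γ : Field.absoluteGaloisGroup ℚ) (Df : W.FineSelmerDualData κ γ),
            Module.Finite ℤ_[3] (RestrictScalars ℤ_[3] (IwasawaAlgebra 3) Df.X)) ∨
      (∃ (W' : WeierstrassCurve ℚ) (_ : W'.IsElliptic), ModPCongruent W' W 3 ∧
        ((∀ (κ : ZpExtension ℚ 3), κ.IsCyclotomic →
            ∃ (γ : Field.absoluteGaloisGroup ℚ) (D : W'.FineSelmerDualData κ γ),
              Module.Finite ℤ_[3] (RestrictScalars ℤ_[3] (IwasawaAlgebra 3) D.X)) ∨
          ∀ (κ : ZpExtension ℚ 3), κ.IsCyclotomic → Set.Finite {s : W'.selmerInfty κ | 3 • s = 0}))) :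
    ∀ (W : WeierstrassCurve ℚ) [W.IsElliptic] [W.IsGloballyMinimal] [Fact (3 : ℕ).Prime],
      W.analyticRank = 0 → ClassO6 W 3 → W.HasIrreducibleModPGaloisRep 3 →
      ¬ (∀ n : ℕ, W.HasSurjectiveModNGaloisRep (3 ^ n : ℕ)) → MissingUpperBoundAt W 3 := by
  have hGZK : rank_eq_analyticRank_of_analyticRank_le_one := hK.2.1
  have hmod : hasEntireLFunction_rat := hK.2.2
  intro W _ _ _ hr hO hirr hns
  haveI : NeZero (W.conductorNorm ℤ) := ⟨(W.conductorNorm_pos_holds).ne'⟩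
  -- CM rows: Burungale–Flach
  by_cases hcm : W.HasCM
  · haveI : Finite W.sha := (hGZK W (by rw [hr]; exact zero_le_one)).2
    exact (lower_and_upper_of_missingPPartAt W 3 (missingPPartAt_of_bsdp W 3
      (Summit.BirchSwinnertonDyer.Rank1Residual.bsdp_cm_rankZero hF.2 hmod hcm hr))).2
  -- Manin-clean ♭ rows: the Heegner road over Matar–Nekovář's printed bound (no currency needed)
  by_cases hclean : ¬ 3 ∣ W.tamagawaProduct ∧
      ∃ D : ModularParametrizationData W (W.conductorNorm ℤ), ¬ (3 : ℤ) ∣ D.maninConstant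
  · obtain ⟨htam, D, hc⟩ := hclean
    exact WildUpperHeegnerRoad.missingUpperBoundAt_wildIrr_rankZero_of_lower_of_rankOne hGZ hKo hMN hGZK hmod hnf
      hBFH h₂ hR hO hirr hr D hc htam
  -- the other rows: ♯ or Manin-dirty — take the currency supplied for this row
  have hsharp : 3 ∣ W.tamagawaProduct ∨ ∀ [NeZero (W.conductorNorm ℤ)]
      (D : ModularParametrizationData W (W.conductorNorm ℤ)), (3 : ℤ) ∣ D.maninConstant := by
    by_cases htam : 3 ∣ W.tamagawaProduct
    · exact Or.inl htam
    · refine Or.inr fun D ↦ ?_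
      by_contra hcD
      exact hclean ⟨htam, D, hcD⟩
  rcases hrow W hr hO hirr hns hsharp hcm with hJD | hA | ⟨W', hW', hcong, hcur⟩
  · -- currency (i): a Manin-clean datum + the sharp index bound ⇒ the sharp Heegner road
    obtain ⟨D, hc, hJ⟩ := hJD
    exact missingUpperBoundAt_wildIrr_rankZero_of_lower_of_rankOne_of_sharpIndexBound hGZ hKo hGZK hmod hnf hBFH
      h₂ hR hO hirr hr D hc hJ
  · -- currency (ii): (A) at the row ⇒ the fine-Selmer port
    exact missingUpperBoundAt_wild_of_irreducible_of_fineSelmerDual_fg hF.1 hGZK hmod W hr hO hirr hA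
  · -- currency (iii): a congruent anchor ⇒ (A) at the row by Lim–Sujatha ⇒ the fine-Selmer port
    haveI := hW'
    have hA : ∀ (κ : ZpExtension ℚ 3), κ.IsCyclotomic →
        ∃ (γ : Field.absoluteGaloisGroup ℚ) (Df : W.FineSelmerDualData κ γ),
          Module.Finite ℤ_[3] (RestrictScalars ℤ_[3] (IwasawaAlgebra 3) Df.X) := by
      rcases hcur with hA' | hfin'
      · exact WildFineSelmerCongruenceFact.conjA_of_modPCongruent hLS (by decide) hcong hA'
      · exact WildFineSelmerCongruenceFact.conjA_of_modPCongruent hLS (by decide) hcong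
          (WildFineSelmerOrdinaryAnchor.conjA_rat_of_finite_selmerInfty_pTorsion W' hfin')
    exact missingUpperBoundAt_wild_of_irreducible_of_fineSelmerDual_fg hF.1 hGZK hmod W hr hO hirr hA

end Summit.BirchSwinnertonDyer.BirchSwinnertonDyer.Theorems.WildUpperHeegnerSharpRoad

end
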